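import Summits.RiemannHypothesis.RiemannHypothesis.Theorems.PfPersistenceF6RigiditySpan

/-!
# Pf-persistence, fake seat 6 (gen 3): the ladder's log-concavity tolerances bound the span by the FIRST gap

mechanism/rigidity campaign; no RH claims.

The harness ladder in log coordinates (`logLadder κ l`: `l 0 < l 1 < l 2 < l 3` for `lg |e₁|, lg o₁, lg e₂, lg o₂`,
with the two tolerance conjuncts `mag`/`lc2` at `κ = 1/4`) lets each consecutive gap exceed the previous one by at
most `κ`.  Hence the whole span `l 3 - l 0 = lg (o₂/|e₁|)` is at most `3 (l 1 - l 0) + 3 κ`, with equality exactly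
on the MAXIMALLY SKEWED ladder (gaps `g, g + κ, g + 2κ`) — the configuration every adversarial rigidity maximiser
of fake-6's row C8-N7(f)/(g) lands on (DATA: `g₂' = g₁' + 0.25`, `g₃' = g₂' + 0.25` to three digits at all cells).
Combined with `gapRigid_span` (p191483) this turns cand-8's forward gap rigidity at fraction `ρ` into a requirement
on the next window's FIRST gap alone: `ρ · span(l) ≤ 3 · g₁(l') + 3κ`.  With the numbers of record (`κ = 1/4`,
tripwire `ρ = 0.96`, current spans `≥ 6.8`) the next window's first gap would have to be at least `≈ 1.93`;
the measured adversarial supremum is `g₁(l') ≈ 1.25` (and the first gap always LOSES more than one dex per served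
step after the sign change), so the rigid corridor is empty of weight-only dial twins for a typed reason.

* `logLadder_gap_two_le`, `logLadder_gap_three_le` — PROVED: `g₂ ≤ g₁ + κ`, `g₃ ≤ g₁ + 2κ`.
* `logLadder_span_le_firstGap` — PROVED: `l 3 - l 0 ≤ 3 (l 1 - l 0) + 3κ`.
* `logLadder_span_bound_tight` — PROVED: the bound is attained (maximally skewed ladder), for every `g > 0`, `κ ≥ 0`.
* `gapRigid_firstGap_lower` — PROVED: `gapRigid ρ l l' → logLadder κ l' → ρ (l 3 - l 0) ≤ 3 (l' 1 - l' 0) + 3κ`.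
* `not_gapRigid_of_firstGap_small` — PROVED: contrapositive form used by the row.
* `firstGap_tripwire` — PROVED closed instance: `κ = 1/4`, `ρ = 0.96`, span `≥ 6.8`, next first gap `≤ 1.9` ⇒
  `¬ gapRigid 0.96 l l'`.

All statements are elementary real (in)equalities about four-term log-ladders; nothing here refers to ζ, to the
explicit formula, or to RH. [folklore]
-/

namespace Summit.RiemannHypothesis.RiemannHypothesis.Theorems.PfPersistence.F6

/-- PROVED: under the `mag` tolerance the second gap exceeds the first by at most `κ`. [folklore] -/
theorem logLadder_gap_two_le {κ : ℝ} {l : ℕ → ℝ} (h : logLadder κ l) :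
    l 2 - l 1 ≤ (l 1 - l 0) + κ := by
  obtain ⟨_, _, _, hmag, _⟩ := h
  linarith

/-- PROVED: under both tolerances the third gap exceeds the first by at most `2κ`. [folklore] -/
theorem logLadder_gap_three_le {κ : ℝ} {l : ℕ → ℝ} (h : logLadder κ l) :
    l 3 - l 2 ≤ (l 1 - l 0) + 2 * κ := by
  obtain ⟨_, _, _, hmag, hlc2⟩ := h
  linarith

/-- PROVED: the span of a valid ladder is at most three first gaps plus `3κ`. [folklore] -/
theorem logLadder_span_le_firstGap {κ : ℝ} {l : ℕ → ℝ} (h : logLadder κ l) :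
    l 3 - l 0 ≤ 3 * (l 1 - l 0) + 3 * κ := by
  obtain ⟨_, _, _, hmag, hlc2⟩ := h
  linarith

/-- PROVED: the span bound is tight — the maximally skewed ladder with gaps `g, g + κ, g + 2κ` is a valid ladder of
span exactly `3g + 3κ` (both tolerances binding). [folklore] -/
theorem logLadder_span_bound_tight {κ g : ℝ} (hκ : 0 ≤ κ) (hg : 0 < g) :
    ∃ l : ℕ → ℝ, logLadder κ l ∧ l 1 - l 0 = g ∧ l 3 - l 0 = 3 * g + 3 * κ := by
  refine ⟨fun i => if i = 0 then 0 else if i = 1 then g else if i = 2 then 2 * g + κ else 3 * g + 3 * κ, ?_, ?_, ?_⟩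
  · refine ⟨?_, ?_, ?_, ?_, ?_⟩ <;> simp <;> linarith
  · simp
  · simp

/-- PROVED: forward gap rigidity at fraction `ρ` into a VALID next-window ladder forces the next window's first gap:
`ρ · span(l) ≤ 3 · g₁(l') + 3κ`. [folklore] -/
theorem gapRigid_firstGap_lower {ρ κ : ℝ} {l l' : ℕ → ℝ} (hR : gapRigid ρ l l') (hL : logLadder κ l') :
    ρ * (l 3 - l 0) ≤ 3 * (l' 1 - l' 0) + 3 * κ :=
  le_trans (gapRigid_span hR) (logLadder_span_le_firstGap hL)

/-- PROVED: if the next window's ladder is valid but its first gap is too small for the current span, gap rigidity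
at `ρ` fails. [folklore] -/
theorem not_gapRigid_of_firstGap_small {ρ κ : ℝ} {l l' : ℕ → ℝ} (hL : logLadder κ l')
    (hlt : 3 * (l' 1 - l' 0) + 3 * κ < ρ * (l 3 - l 0)) : ¬ gapRigid ρ l l' :=
  fun hR => absurd (gapRigid_firstGap_lower hR hL) (not_le.mpr hlt)

/-- PROVED (numbers of record as a closed instance): harness tolerance `κ = 1/4`, cand8-012 tripwire `ρ = 0.96`,
a current span of at least `6.8` dex (every adversarial maximiser and every certified member has `6.8–10.4`) and a
next-window first gap of at most `1.9` dex (measured supremum `≈ 1.25`) are incompatible with gap rigidity. [folklore] -/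
theorem firstGap_tripwire {l l' : ℕ → ℝ} (hL : logLadder (1/4) l') (hspan : 6.8 ≤ l 3 - l 0)
    (hg : l' 1 - l' 0 ≤ 1.9) : ¬ gapRigid 0.96 l l' :=
  not_gapRigid_of_firstGap_small hL (by norm_num at hspan hg ⊢; linarith)

end Summit.RiemannHypothesis.RiemannHypothesis.Theorems.PfPersistence.F6
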